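import Mathlib
import Summits.MatrixMultiplication.MatrixMultiplication.Theses.LevelGradedCohnUmans

/-!
# `SnLevelDesigns` (stmt-MatrixMultiplication-7613), line `garnir-annihilator`: S3 `stub_blockDescent` — block descent (rank-matrix minimality + position weight)

Crux `Summit.MatrixMultiplication.MatrixMultiplication.Theses.LevelGradedCohnUmans.SnLevelDesigns`; skeleton
`Cruxes/SnLevelDesigns/Lines/garnir-annihilator.lean` (lead reshape, 7 registered stubs); this file proves the registered stub
`stub_blockDescent` verbatim (name + signature, tree-only vocabulary) and lands `--supports stmt-MatrixMultiplication-7613`.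

If `p` is strictly decreasing on the blocks of `blk`, then every proper within-block rearrangement `p * σ`
(`σ ∈ S_blk`, `σ ≠ 1`) is Bruhat-below `p` in the rank-matrix order (block by block, `p` puts the largest values of a
block on its earliest positions, minimising `#{a < i : w a < j}`) and has strictly larger position weight
`Φ(w) = Σ_i i·w(i)` (`p` is the unique `Φ`-minimum of its block coset: an un-sorted pair `a < b`, `w a < w b` in one
block gives `Φ(w ∘ swap a b) = Φ(w) - (b-a)(w b - w a) < Φ(w)`, and iterating reaches `p`).
-/

set_option linter.dupNamespace false

namespace Summit.MatrixMultiplication.MatrixMultiplication.Theorems.SnLevelDesigns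

open scoped BigOperators

/-- Splitting a sum over `Fin n` at two distinct indices `a ≠ b`. -/
theorem bd_sum_split {n : ℕ} (f : Fin n → ℕ) {a b : Fin n} (hne : a ≠ b) :
    ∑ i, f i = f a + f b + ∑ i ∈ (Finset.univ.erase a).erase b, f i := by
  rw [add_assoc, Finset.add_sum_erase _ _ (Finset.mem_erase.2 ⟨hne.symm, Finset.mem_univ b⟩),
    Finset.add_sum_erase _ _ (Finset.mem_univ a)]

/-- One-swap position-weight drop: sorting an increasing pair `a < b`, `g a < g b` into a decreasing
one strictly decreases the position weight `Φ(w) = Σ i·w(i)`. -/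
theorem bd_sum_swap_lt {n : ℕ} (g : Equiv.Perm (Fin n)) {a b : Fin n} (hab : a < b)
    (hg : g a < g b) :
    (∑ i : Fin n, (i : ℕ) * (((g * Equiv.swap a b) i : Fin n) : ℕ)) <
      ∑ i : Fin n, (i : ℕ) * ((g i : Fin n) : ℕ) := by
  have hne : a ≠ b := hab.ne
  have h1 : (∑ i : Fin n, (i : ℕ) * (((g * Equiv.swap a b) i : Fin n) : ℕ)) =
      (a : ℕ) * (((g * Equiv.swap a b) a : Fin n) : ℕ) +
        (b : ℕ) * (((g * Equiv.swap a b) b : Fin n) : ℕ) +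
        ∑ i ∈ (Finset.univ.erase a).erase b, (i : ℕ) * (((g * Equiv.swap a b) i : Fin n) : ℕ) :=
    bd_sum_split _ hne
  have h2 : (∑ i : Fin n, (i : ℕ) * ((g i : Fin n) : ℕ)) =
      (a : ℕ) * ((g a : Fin n) : ℕ) + (b : ℕ) * ((g b : Fin n) : ℕ) +
        ∑ i ∈ (Finset.univ.erase a).erase b, (i : ℕ) * ((g i : Fin n) : ℕ) :=
    bd_sum_split _ hne
  have h3 : (∑ i ∈ (Finset.univ.erase a).erase b, (i : ℕ) * (((g * Equiv.swap a b) i : Fin n) : ℕ)) =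
      ∑ i ∈ (Finset.univ.erase a).erase b, (i : ℕ) * ((g i : Fin n) : ℕ) := by
    refine Finset.sum_congr rfl fun i hi => ?_
    have hib : i ≠ b := (Finset.mem_erase.1 hi).1
    have hia : i ≠ a := (Finset.mem_erase.1 (Finset.mem_erase.1 hi).2).1
    rw [Equiv.Perm.mul_apply, Equiv.swap_apply_of_ne_of_ne hia hib]
  rw [h1, h2, h3, Equiv.Perm.mul_apply, Equiv.Perm.mul_apply, Equiv.swap_apply_left,
    Equiv.swap_apply_right]
  have hab' : (a : ℕ) < b := hab
  have hg' : ((g a : Fin n) : ℕ) < g b := hg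
  have key : (a : ℕ) * ((g b : Fin n) : ℕ) + (b : ℕ) * ((g a : Fin n) : ℕ) <
      (a : ℕ) * ((g a : Fin n) : ℕ) + (b : ℕ) * ((g b : Fin n) : ℕ) := by
    nlinarith
  exact Nat.add_lt_add_right key _

/-- One-swap rank-matrix comparison: sorting an increasing pair `a < b`, `g a < g b` into a decreasing
one does not increase any of the counts `#{x < i : w x < j}`. -/
theorem bd_card_swap_le {n : ℕ} (g : Equiv.Perm (Fin n)) {a b : Fin n} (hab : a < b)
    (hg : g a < g b) (i j : ℕ) :
    (Finset.univ.filter (fun x : Fin n => (x : ℕ) < i ∧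
        (((g * Equiv.swap a b) x : Fin n) : ℕ) < j)).card ≤
      (Finset.univ.filter (fun x : Fin n => (x : ℕ) < i ∧ ((g x : Fin n) : ℕ) < j)).card := by
  have hab' : (a : ℕ) < b := hab
  have hg' : ((g a : Fin n) : ℕ) < g b := hg
  by_cases hbi : (b : ℕ) < i
  · calc (Finset.univ.filter (fun x : Fin n => (x : ℕ) < i ∧
            (((g * Equiv.swap a b) x : Fin n) : ℕ) < j)).card
        _ ≤ ((Finset.univ.filter (fun x : Fin n => (x : ℕ) < i ∧ ((g x : Fin n) : ℕ) < j)).image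
              (Equiv.swap a b)).card := by
          refine Finset.card_le_card fun x hx => ?_
          rw [Finset.mem_filter, Equiv.Perm.mul_apply] at hx
          refine Finset.mem_image.2 ⟨Equiv.swap a b x, ?_, Equiv.swap_apply_self _ _ _⟩
          refine Finset.mem_filter.2 ⟨Finset.mem_univ _, ?_, hx.2.2⟩
          rcases eq_or_ne x a with rfl | hxa
          · rw [Equiv.swap_apply_left]; exact hbi
          rcases eq_or_ne x b with rfl | hxb
          · rw [Equiv.swap_apply_right]; exact hab'.trans hbi
          rw [Equiv.swap_apply_of_ne_of_ne hxa hxb]; exact hx.2.1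
        _ ≤ _ := Finset.card_image_le
  · refine Finset.card_le_card fun x hx => ?_
    rw [Finset.mem_filter, Equiv.Perm.mul_apply] at hx
    refine Finset.mem_filter.2 ⟨Finset.mem_univ _, hx.2.1, ?_⟩
    have hxb : x ≠ b := fun h => hbi (h ▸ hx.2.1)
    rcases eq_or_ne x a with rfl | hxa
    · rw [Equiv.swap_apply_left] at hx; exact hg'.trans hx.2.2
    rw [Equiv.swap_apply_of_ne_of_ne hxa hxb] at hx; exact hx.2.2

/-- Swapping two positions of one block keeps a permutation inside its block coset `p · S_blk`. -/
theorem bd_coset_swap {n : ℕ} (blk : Fin n → Fin n) (p g : Equiv.Perm (Fin n)) {a b : Fin n}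
    (hblk : blk a = blk b) (hg : ∀ x, blk (p.symm (g x)) = blk x) :
    ∀ x, blk (p.symm ((g * Equiv.swap a b) x)) = blk x := by
  intro x
  rw [Equiv.Perm.mul_apply, hg]
  rcases eq_or_ne x a with rfl | hxa
  · rw [Equiv.swap_apply_left]; exact hblk.symm
  rcases eq_or_ne x b with rfl | hxb
  · rw [Equiv.swap_apply_right]; exact hblk
  rw [Equiv.swap_apply_of_ne_of_ne hxa hxb]

/-- Uniqueness of the block-decreasing representative: a block-decreasing member of the block coset
of a block-decreasing `p` is `p` itself. -/
theorem bd_unique {n : ℕ} (blk : Fin n → Fin n) (p g : Equiv.Perm (Fin n))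
    (hp : ∀ a b : Fin n, blk a = blk b → a < b → p b < p a)
    (hgd : ∀ a b : Fin n, blk a = blk b → a < b → g b < g a)
    (hg : ∀ x, blk (p.symm (g x)) = blk x) : g = p := by
  suffices h : ∀ k : ℕ, ∀ x : Fin n, (x : ℕ) = k → g x = p x from Equiv.ext fun x => h x x rfl
  intro k
  induction k using Nat.strong_induction_on with
  | _ k ih =>
    rintro x rfl
    by_contra hx
    have h1 : g x < p x := by
      have hpa : p (p.symm (g x)) = g x := p.apply_symm_apply (g x)
      have hne : p.symm (g x) ≠ x := fun h => hx (by rw [← hpa, h])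
      rcases lt_or_gt_of_ne hne with hlt | hlt
      · exact absurd (g.injective ((ih _ hlt _ rfl).trans hpa)) hne
      · calc g x = p (p.symm (g x)) := hpa.symm
          _ < p x := hp x _ (hg x).symm hlt
    have h2 : p x < g x := by
      have hga : g (g.symm (p x)) = p x := g.apply_symm_apply (p x)
      have hblk : blk x = blk (g.symm (p x)) := by
        have h := hg (g.symm (p x))
        rw [hga, Equiv.symm_apply_apply] at h
        exact h
      have hne : g.symm (p x) ≠ x := fun h => hx (by rw [← hga, h])
      rcases lt_or_gt_of_ne hne with hlt | hlt
      · exact absurd (p.injective ((ih _ hlt _ rfl).symm.trans hga)) hne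
      · calc p x = g (g.symm (p x)) := hga.symm
          _ < g x := hgd x _ hblk hlt
    exact lt_asymm h1 h2

/-- Block descent along the coset: every member `g` of the block coset of a block-decreasing `p` is
Bruhat-above `p` in the rank-matrix order, and has strictly larger position weight unless `g = p`
(strong induction on the position weight, one sorting swap at a time). -/
theorem bd_main {n : ℕ} (blk : Fin n → Fin n) (p : Equiv.Perm (Fin n))
    (hp : ∀ a b : Fin n, blk a = blk b → a < b → p b < p a) (m : ℕ) :
    ∀ g : Equiv.Perm (Fin n), (∑ i : Fin n, (i : ℕ) * ((g i : Fin n) : ℕ)) ≤ m →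
      (∀ x, blk (p.symm (g x)) = blk x) →
        (∀ i j : ℕ,
            (Finset.univ.filter (fun a : Fin n => (a : ℕ) < i ∧ ((p a : Fin n) : ℕ) < j)).card ≤
              (Finset.univ.filter (fun a : Fin n => (a : ℕ) < i ∧ ((g a : Fin n) : ℕ) < j)).card) ∧
          (g ≠ p → (∑ i : Fin n, (i : ℕ) * ((p i : Fin n) : ℕ)) <
            ∑ i : Fin n, (i : ℕ) * ((g i : Fin n) : ℕ)) := by
  induction m using Nat.strong_induction_on with
  | _ m ih =>
    intro g hgm hg
    by_cases hdec : ∀ a b : Fin n, blk a = blk b → a < b → g b < g a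
    · have hgp : g = p := bd_unique blk p g hp hdec hg
      subst hgp
      exact ⟨fun _ _ => le_rfl, fun h => absurd rfl h⟩
    · push Not at hdec
      obtain ⟨a, b, hblk, hab, hle⟩ := hdec
      have hlt : g a < g b := lt_of_le_of_ne hle fun h => hab.ne (g.injective h)
      have hg' := bd_coset_swap blk p g hblk hg
      have hΦ := bd_sum_swap_lt g hab hlt
      obtain ⟨h1, h2⟩ := ih _ (lt_of_lt_of_le hΦ hgm) (g * Equiv.swap a b) le_rfl hg'
      refine ⟨fun i j => (h1 i j).trans (bd_card_swap_le g hab hlt i j), fun _ => ?_⟩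
      rcases eq_or_ne (g * Equiv.swap a b) p with h | h
      · rw [← h]; exact hΦ
      · exact (h2 h).trans hΦ

/-- **`stub_blockDescent`** (registered stub of crux stmt-MatrixMultiplication-7613, line `garnir-annihilator`).
If `p` is strictly decreasing on the blocks of `blk`, then every proper within-block rearrangement `p * σ`
(`σ` block-preserving, `σ ≠ 1`) is Bruhat-below `p` in the rank-matrix order
(`#{a < i : p a < j} ≤ #{a < i : (p σ) a < j}` for all `i j`) and has strictly larger position weight
`Σ i·w(i)`. -/
theorem stub_blockDescent :
    ∀ (n : ℕ) (blk : Fin n → Fin n) (p : Equiv.Perm (Fin n)),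
      (∀ a b : Fin n, blk a = blk b → a < b → p b < p a) →
        ∀ σ ∈ Finset.univ.filter (fun σ : Equiv.Perm (Fin n) => ∀ x, blk (σ x) = blk x), σ ≠ 1 →
          (∀ i j : ℕ,
              (Finset.univ.filter (fun a : Fin n => (a : ℕ) < i ∧ ((p a : Fin n) : ℕ) < j)).card ≤
                (Finset.univ.filter (fun a : Fin n => (a : ℕ) < i ∧ (((p * σ) a : Fin n) : ℕ) < j)).card) ∧
            (∑ i : Fin n, (i : ℕ) * ((p i : Fin n) : ℕ)) < ∑ i : Fin n, (i : ℕ) * (((p * σ) i : Fin n) : ℕ) := by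
  intro n blk p hp σ hσ hσ1
  have hσb : ∀ x, blk (σ x) = blk x := (Finset.mem_filter.1 hσ).2
  have hg : ∀ x, blk (p.symm ((p * σ) x)) = blk x := fun x => by
    rw [Equiv.Perm.mul_apply, Equiv.symm_apply_apply]; exact hσb x
  have hne : p * σ ≠ p := fun h => hσ1 (mul_left_cancel (h.trans (mul_one p).symm))
  obtain ⟨h1, h2⟩ := bd_main blk p hp _ (p * σ) le_rfl hg
  exact ⟨h1, h2 hne⟩

end Summit.MatrixMultiplication.MatrixMultiplication.Theorems.SnLevelDesigns
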